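import Summits.BirchSwinnertonDyer.BirchSwinnertonDyer.Theorems.SemiOrdinaryEisensteinDescentWildSplitEisensteinValueAtOneVMinfCurrency
import HarnessLib

/-!
# Crux E_𝟙^V `WildSplitEisensteinValueAtOneV` (stmt-BirchSwinnertonDyer-26610), line `index` — SKELETON v4 «minf» (STAGED, OFFERED — NOT
# registered unless the SOED pen / the next lead prefers it to v3): the research stub in M_∞ (refined-Kolyvagin) CURRENCY

v3 (registered 6d772f56a67e5096, soed-p1-w3 g17): stubs {`stub_indexLowerBoundFH` = I_FH (research), `stub_publishedInputs` = PUB 20389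
(print)}. v4 (soed-p1-w3 g18, 2026-08-28) replaces I_FH by its EQUIVALENT (modulo Kolyvagin + Matar–Nekovář 2019 Thm. 0.7 both readings,
`…WildSplitEisensteinValueAtOneVMinfCurrency.indexLowerBoundLeAt_FH_iff_minf_le`, p635290) Heegner-point form, and PUB by the two print facts
the composition actually consumes:

  crux ⟸ stub_minfLeFH            (RKC₃^FH,≤ — THE research stub: at every odd Friedberg–Hoffstein datum of the O6 onto r₁ cell,
                                   McCallum's `M_∞(Dt, H.β, ι; 3) ≤ ord₃∏c_ℓ(E) + v₃(c(Dt))`, i.e. SOME derived Heegner point `P_n`,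
                                   `n ∈ S_r(u+1)`, is not `3^{u+1}`-divisible in `E(K[n])` for some `u ≤ ord₃(c·∏c_ℓ)`; decidable PAIR BY
                                   PAIR by computing ONE derived point (Jetchev–Lauter–Stein 2009 §4); research-open class-wide — W. Zhang
                                   2014 / BCGS / arXiv:2601.14504 need p ≥ 5 good ordinary; no BD-admissible primes at 3)
       + stub_kolyvagin           (print: Kolyvagin 1990 Thm. A, ∀-form = conjunct 2 of `PublishedInputsWildThree`)
       + stub_matarNekovarLower   (print: Matar–Nekovář 2019 Thm. 0.7 / §0.11, certificate form under irreducibility — the tree's named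
                                   Literature fact, verbatim)

TRADE-OFF vs v3 (for the pen): same research content (equivalent modulo print); v4's research stub is instrument-shaped (its negation is
«all derived points `3^{s′}`-divisible to depth `ord₃(c∏c_ℓ)+1` at one index-excess datum», the disprover's exact target) and mentions no `#Ш`;
v4 leans on ONE more print fact (MN19-lower) than v3, whose I_FH hides the structure theorem inside the research stub.
Composition = `…MinfCurrency.valueAtOneV_of_minfLeFH_of_kolyvagin` (sorry-free; PT1/PT2/C are tree theorems inside p632995).
Hardest stub: stub_minfLeFH (XL, research). BSD is not proved by any of this.
-/

set_option autoImplicit false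
set_option linter.dupNamespace false

noncomputable section

open scoped Classical

namespace Summit.BirchSwinnertonDyer.BirchSwinnertonDyer.Theorems.SemiOrdinaryEisensteinDescentWildSplitEisensteinValueAtOneV

open Summit.BirchSwinnertonDyer.BirchSwinnertonDyer.Theses.SemiOrdinaryEisensteinDescent
  Summit.BirchSwinnertonDyer.BirchSwinnertonDyer.Theorems

/-- **Stub `stub_minfLeFH`** (THE research stub, M_∞ currency): at every Heegner datum of the O6 / ρ̄₃-onto / r_an = 1 cell with
`L(E^(d_K),1) ≠ 0`, `P = y_K` non-torsion and `d_K` odd, McCallum's `M_∞` of the Kolyvagin system of the frame `(Dt, H.β, ι)` at `3` is at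
most `ord₃∏c_ℓ(E) + v₃(c(Dt))` (the `≤`-half of W. Zhang's refined Kolyvagin conjecture with the Manin slack). Not in print at an additive 3. -/
theorem stub_minfLeFH :
    ∀ (W : WeierstrassCurve ℚ) [W.IsElliptic] [W.IsGloballyMinimal] (N : ℕ) [NeZero N] (K : Type) [Field K] [NumberField K] (Dt : Literature.NumberTheory.EllipticCurves.ModularForms.ModularParametrizationData W N) (H : Literature.NumberTheory.EllipticCurves.HeegnerDatum N (NumberField.discr K)) (ι : K →+* ℂ) (P : (W.baseChange K).toAffine.Point), Summit.BirchSwinnertonDyer.Rank1Residual.Additive.ClassO6 W 3 → W.HasSurjectiveModNGaloisRep 3 → W.analyticRank = 1 → W.conductorNorm ℤ = N → Literature.NumberTheory.EllipticCurves.IsImaginaryQuadratic K → Literature.NumberTheory.EllipticCurves.SatisfiesHeegnerHypothesis N K → (W.quadraticTwist (NumberField.discr K : ℚ)).entireLFunction 1 ≠ 0 → (WeierstrassCurve.Affine.Point.map ι.toRatAlgHom) P = Literature.NumberTheory.EllipticCurves.ModularForms.heegnerPointComplex Dt H → ¬ IsOfFinAddOrder P → Odd (NumberField.discr K) → Summit.BirchSwinnertonDyer.Rank1Residual.X11b.Three.Koly.Minf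 Dt H.β ι 3 ≤ ((padicValNat 3 W.tamagawaProduct + padicValNat 3 Dt.c.natAbs : ℕ) : ℕ∞) := by
  sorry

/-- **Stub `stub_kolyvagin`** (print, by name): Kolyvagin 1990 Thm. A in the tree's ∀-form (= conjunct 2 of `PublishedInputsWildThree`). -/
theorem stub_kolyvagin :
    ∀ (N : ℕ) [NeZero N] (W : WeierstrassCurve ℚ) (K : Type) [Field K] [NumberField K], Literature.NumberTheory.EllipticCurves.kolyvagin N W K := by
  sorry

/-- **Stub `stub_matarNekovarLower`** (print, by name): Matar–Nekovář 2019 Thm. 0.7 / §0.11, certificate (lower) form under irreducibility,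
the tree's named Literature fact verbatim. -/
theorem stub_matarNekovarLower :
    Literature.NumberTheory.EllipticCurves.MatarNekovar2019.thm07_pow_dvd_card_sha_primary_of_certificate_of_irreducible := by
  sorry

/-- **Composition** (sorry-free): the crux `WildSplitEisensteinValueAtOneV` BY NAME from the three stubs — p635290 §2. -/
theorem WildSplitEisensteinValueAtOneV_of : WildSplitEisensteinValueAtOneV :=
  WildSplitEisensteinValueAtOneVMinfCurrency.valueAtOneV_of_minfLeFH_of_kolyvagin stub_kolyvagin stub_matarNekovarLower stub_minfLeFH

end Summit.BirchSwinnertonDyer.BirchSwinnertonDyer.Theorems.SemiOrdinaryEisensteinDescentWildSplitEisensteinValueAtOneV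

end
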